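import Mathlib
import Summits.Schanuel.Schanuel.Theorems.RootDecomp1EAnchorToolkit
import Summits.Schanuel.Schanuel.Theses.RootDecomp1E
import Literature.Barriers.Schanuel.LargeTranscendenceDegree
import Literature.NumberTheory.Transcendental.BakerLogarithmsConclusion
import Summits.Schanuel.Schanuel.Theorems.RootDecomp1EMultiplicationTypeLeavesDictionary

/-!
# RootDecomp1E — leaves of ROUND 7 «MultiplicationType» (lens 2, gen 7), part 4/4: (g) GRID BLINDNESS of the Conjecture-2.3 numerology on both residual sectors · (h₃) read on item 31410 at length 4

MONOLITH = `g7/RootDecomp1EMultiplicationTypeLeaves.port.lean` (994 lines, lean check rc0 · 0 · 0 against the live tree 2026-08-30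
≈09:10Z); this is PART 4/4 of its split at section boundaries for the 400-line cap (one namespace
`…Theorems.RootDecomp1EMultiplicationTypeLeaves` across the four modules; part k imports part k−1).  Parts 2–4 typecheck once
their predecessor is in the tree (the monolith is the checked reference).
Target `Summits/Schanuel/Schanuel/Theorems/RootDecomp1EMultiplicationTypeLeavesGridBlind.lean`, `--supports stmt-Schanuel-31409` (EStableDefectOne; parts 3–4 equally
concern stmt-Schanuel-31410 PlainDefectOne).  See the monolith header for the per-theorem description.
-/

set_option linter.dupNamespace false

noncomputable section

namespace Summit.Schanuel.Schanuel.Theorems.RootDecomp1EMultiplicationTypeLeaves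

open Complex IntermediateField Module Polynomial
open Summit.Schanuel.Schanuel.Theorems.RootDecomp1EAnchor (isAlgebraic_of_mem_adjoin
  trdeg_adjoin_le_of_isAlgebraic mem_adjoin_of_mem_span exp_isAlgebraic_of_mem_span)
open Literature.Barriers.Schanuel (gridField₂ smallTrdeg_thm_2_9_pos smallTrdeg_thm_2_9_two_two
  WaldschmidtConjecture_2_3 trdeg_mono)
open Literature.NumberTheory.Transcendental (baker_holds)
open Summit.Schanuel.Schanuel.Theorems.RootDecomp1EEStableRung (mul_mem_span_of_gens)


/-! ## (g) GRID BLINDNESS of the Conjecture-2.3 numerology on the residual sectors -/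

/-- A nonzero dilate `x·c` of a ℚ-free `d`-tuple inside `span_ℚ z` (`z` free of length `n`) has `d ≤ n`. -/
theorem grid_side_le_length {n d : ℕ} {z : Fin n → ℂ} (hz : LinearIndependent ℚ z)
    {x : Fin d → ℂ} (hx : LinearIndependent ℚ x) {c : ℂ} (hc : c ≠ 0)
    (h : ∀ i, x i * c ∈ Submodule.span ℚ (Set.range z)) : d ≤ n := by
  set V : Submodule ℚ ℂ := Submodule.span ℚ (Set.range z) with hV
  haveI : Module.Finite ℚ ↥V := FiniteDimensional.span_of_finite ℚ (Set.finite_range z)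
  let f : Fin d → ↥V := fun i => ⟨x i * c, h i⟩
  have hf : LinearIndependent ℚ f := by
    apply LinearIndependent.of_comp V.subtype
    have hxc : LinearIndependent ℚ (fun i => x i * c) := by
      rw [Fintype.linearIndependent_iff] at hx ⊢
      intro g hg i
      have hsum : (∑ i, g i • x i) * c = 0 := by
        rw [Finset.sum_mul]
        simpa [smul_mul_assoc] using hg
      rcases mul_eq_zero.mp hsum with h0 | h0
      · exact hx g h0 i
      · exact absurd h0 hc
    exact hxc
  have hcard := hf.fintype_card_le_finrank
  rw [hV, finrank_span_eq_card hz] at hcard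
  simpa using hcard

/-- SUB-MINIMALITY ALONE PINS THE TRANSCENDENCE DEGREE FROM BELOW: if every shorter free tuple inside `span_ℚ z`
satisfies `S⁻`, then `trdeg ℚ(z, e^z) ≥ n − 2` (apply the hypothesis to `z` minus its last entry). -/
theorem sub_two_le_trdeg_of_subMinimal {n : ℕ} (z : Fin n → ℂ) (hz : LinearIndependent ℚ z)
    (hsub : ∀ (m : ℕ) (w : Fin m → ℂ), m < n → LinearIndependent ℚ w →
      (∀ j, w j ∈ Submodule.span ℚ (Set.range z)) →
      (m : Cardinal) ≤ Algebra.trdeg ℚ ↥(IntermediateField.adjoin ℚ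
        (Set.range w ∪ Set.range (Complex.exp ∘ w))) + 1) :
    ((n - 2 : ℕ) : Cardinal) ≤ Algebra.trdeg ℚ ↥(adjoin ℚ (Set.range z ∪ Set.range (cexp ∘ z))) := by
  rcases Nat.lt_or_ge n 2 with hn | hn
  · have : n - 2 = 0 := by omega
    simp [this]
  obtain ⟨k, rfl⟩ : ∃ k, n = k + 2 := ⟨n - 2, by omega⟩
  have hk : k + 2 - 2 = k := by omega
  rw [hk]
  set w : Fin (k + 1) → ℂ := z ∘ Fin.castSucc with hw
  have hwli : LinearIndependent ℚ w := hz.comp _ (Fin.castSucc_injective _)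
  have hwmem : ∀ j, w j ∈ Submodule.span ℚ (Set.range z) := fun j =>
    Submodule.subset_span ⟨Fin.castSucc j, rfl⟩
  have h1 := hsub (k + 1) w (by omega) hwli hwmem
  have hmono : Algebra.trdeg ℚ ↥(adjoin ℚ (Set.range w ∪ Set.range (cexp ∘ w))) ≤
      Algebra.trdeg ℚ ↥(adjoin ℚ (Set.range z ∪ Set.range (cexp ∘ z))) := by
    refine trdeg_mono (adjoin.mono ℚ _ _ ?_)
    rintro t (⟨j, rfl⟩ | ⟨j, rfl⟩)
    · exact Or.inl ⟨Fin.castSucc j, rfl⟩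
    · exact Or.inr ⟨Fin.castSucc j, rfl⟩
  have h2 : ((k : Cardinal) + 1) ≤ Algebra.trdeg ℚ ↥(adjoin ℚ (Set.range z ∪ Set.range (cexp ∘ z))) + 1 := by
    have := h1.trans (add_le_add hmono (le_refl (1 : Cardinal)))
    simpa [Nat.cast_succ] using this
  exact Cardinal.add_one_le_add_one_iff.mp h2

/-- The numerology: for `d, ℓ ≤ n` and `n ≥ 5`, `[dℓ/(ℓ+d)] + 1 ≤ n − 2`. -/
theorem conj23_value_le_sub_two {n d l : ℕ} (hn : 5 ≤ n) (hd : d ≤ n) (hl : l ≤ n) :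
    d * l / (l + d) + 1 ≤ n - 2 := by
  rcases Nat.eq_zero_or_pos (l + d) with h0 | hpos
  · rw [h0, Nat.div_zero]; omega
  have hlt : d * l < (n - 2) * (l + d) := by
    obtain ⟨k, rfl⟩ : ∃ k, n = k + 5 := ⟨n - 5, by omega⟩
    have hk : k + 5 - 2 = k + 3 := by omega
    rw [hk]
    have h1 : d * l ≤ (k + 5) * l := Nat.mul_le_mul_right l hd
    have h2 : d * l ≤ d * (k + 5) := Nat.mul_le_mul_left d hl
    nlinarith
  have := (Nat.div_lt_iff_lt_mul hpos).mpr hlt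
  omega

/-- … and with one extra unit (a hypothetical «+1» hybrid improvement) still `≤ n − 2` once `n ≥ 7`. -/
theorem conj23_value_succ_le_sub_two {n d l : ℕ} (hn : 7 ≤ n) (hd : d ≤ n) (hl : l ≤ n) :
    d * l / (l + d) + 2 ≤ n - 2 := by
  rcases Nat.eq_zero_or_pos (l + d) with h0 | hpos
  · rw [h0, Nat.div_zero]; omega
  have hlt : d * l < (n - 3) * (l + d) := by
    obtain ⟨k, rfl⟩ : ∃ k, n = k + 7 := ⟨n - 7, by omega⟩
    have hk : k + 7 - 3 = k + 4 := by omega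
    rw [hk]
    have h1 : d * l ≤ (k + 7) * l := Nat.mul_le_mul_right l hd
    have h2 : d * l ≤ d * (k + 7) := Nat.mul_le_mul_left d hl
    nlinarith
  have := (Nat.div_lt_iff_lt_mul hpos).mpr hlt
  omega

/-- At `n = 4` the only grid escaping the count is `(4,4)`. -/
theorem conj23_value_le_two_of_le_four {d l : ℕ} (hd : d ≤ 4) (hl : l ≤ 4) (h44 : ¬ (d = 4 ∧ l = 4)) :
    d * l / (l + d) + 1 ≤ 2 := by
  interval_cases d <;> interval_cases l <;> simp_all

/-- **Two parallel full-rank dilates force the E-stable type.**  If `span_ℚ z` (free, length `n ≥ 1`) contains `x·y₀` and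
`x·y₁` for one free `n`-tuple `x` and a ℚ-free pair `(y₀, y₁)`, then `y₁/y₀` is an irrational ALGEBRAIC multiplier of
`span_ℚ z`: the span is E-stable. -/
theorem eStable_of_two_dilates {n : ℕ} (hn : 1 ≤ n) (z : Fin n → ℂ) (hz : LinearIndependent ℚ z)
    (x : Fin n → ℂ) (hx : LinearIndependent ℚ x) {y₀ y₁ : ℂ} (hy : LinearIndependent ℚ ![y₀, y₁])
    (h₀ : ∀ i, x i * y₀ ∈ Submodule.span ℚ (Set.range z))
    (h₁ : ∀ i, x i * y₁ ∈ Submodule.span ℚ (Set.range z)) :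
    ∃ β : ℂ, IsAlgebraic ℚ β ∧ β ∉ Set.range (algebraMap ℚ ℂ) ∧
      ∀ i, β * z i ∈ Submodule.span ℚ (Set.range z) := by
  have hy₀ : y₀ ≠ 0 := by simpa using hy.ne_zero 0
  set V : Submodule ℚ ℂ := Submodule.span ℚ (Set.range z) with hV
  haveI : Module.Finite ℚ ↥V := FiniteDimensional.span_of_finite ℚ (Set.finite_range z)
  -- the dilate `x·y₀` spans `V`
  set W : Submodule ℚ ℂ := Submodule.span ℚ (Set.range fun i => x i * y₀) with hW
  have hWV : W ≤ V := Submodule.span_le.mpr (by rintro _ ⟨i, rfl⟩; exact h₀ i)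
  have hxli : LinearIndependent ℚ (fun i => x i * y₀) := by
    rw [Fintype.linearIndependent_iff] at hx ⊢
    intro g hg i
    have hsum : (∑ i, g i • x i) * y₀ = 0 := by
      rw [Finset.sum_mul]
      simpa [smul_mul_assoc] using hg
    rcases mul_eq_zero.mp hsum with h0 | h0
    · exact hx g h0 i
    · exact absurd h0 hy₀
  have hWeq : W = V := by
    apply Submodule.eq_of_le_of_finrank_eq hWV
    rw [hW, hV, finrank_span_eq_card hxli, finrank_span_eq_card hz]
  set β : ℂ := y₁ * y₀⁻¹ with hβ
  have hβW : ∀ i, β * (x i * y₀) ∈ W := by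
    intro i
    have : β * (x i * y₀) = x i * y₁ := by
      rw [hβ]; field_simp
    rw [this, hWeq]
    exact h₁ i
  have hβV : ∀ v ∈ V, β * v ∈ V := by
    intro v hv
    rw [← hWeq] at hv ⊢
    exact mul_mem_span_of_gens hβW hv
  have hβz : ∀ i, β * z i ∈ Submodule.span ℚ (Set.range z) := fun i =>
    hβV _ (Submodule.subset_span ⟨i, rfl⟩)
  obtain ⟨i₀⟩ : Nonempty (Fin n) := ⟨⟨0, hn⟩⟩
  have halg : IsAlgebraic ℚ β :=
    isAlgebraic_of_mul_mem_span z β hβV (Submodule.subset_span ⟨i₀, rfl⟩) (hz.ne_zero i₀)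
  refine ⟨β, halg, ?_, hβz⟩
  rintro ⟨r, hr⟩
  have hr' : (r : ℂ) = β := by rw [← hr]; simp
  have hrel : (r : ℚ) • y₀ + (-1 : ℚ) • y₁ = 0 := by
    have : (r : ℂ) * y₀ = y₁ := by rw [hr', hβ]; field_simp
    simp [Rat.smul_def, ← this]
  have := (LinearIndependent.pair_iff.mp hy) r (-1) hrel
  norm_num at this

/-- **GRID BLINDNESS, all lengths `n ≥ 5` (both sectors).**  At a SUB-MINIMAL configuration (every shorter free tuple in
`span_ℚ z` satisfies `S⁻` — the induction hypothesis carried by `EStableDefectOne` / `PlainDefectOne`), the `t₂`-value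
`[dℓ/(ℓ+d)] + 1` of Conjecture 2.3 (`Literature.Barriers.Schanuel.WaldschmidtConjecture_2_3`; a fortiori of Thm 2.7 / the
pure clauses of Thm 2.9) of ANY grid `x·y ⊆ span_ℚ z` with `x`, `y` free is `≤ n − 2 ≤ trdeg ℚ(z, e^z)` ALREADY — so no such
clause can ever certify the `S⁻`-threshold `n − 1`: the numerology is blind to both residual sectors from length 5 on.
(Hybrid clauses with ALGEBRAIC exponentials — Brownawell–Waldschmidt, section (e) — are not of this form; they are exactly how
plain triples get decided.  Even a uniform «+1» on top of the Conjecture-2.3 value stays blind for `n ≥ 7`: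
`conj23_blind_succ_of_subMinimal`.) -/
theorem conj23_blind_of_subMinimal {n : ℕ} (hn : 5 ≤ n) (z : Fin n → ℂ) (hz : LinearIndependent ℚ z)
    (hsub : ∀ (m : ℕ) (w : Fin m → ℂ), m < n → LinearIndependent ℚ w →
      (∀ j, w j ∈ Submodule.span ℚ (Set.range z)) →
      (m : Cardinal) ≤ Algebra.trdeg ℚ ↥(IntermediateField.adjoin ℚ
        (Set.range w ∪ Set.range (Complex.exp ∘ w))) + 1)
    {d l : ℕ} (x : Fin d → ℂ) (y : Fin l → ℂ) (hx : LinearIndependent ℚ x) (hy : LinearIndependent ℚ y)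
    (hxy : ∀ i j, x i * y j ∈ Submodule.span ℚ (Set.range z)) :
    ((d * l / (l + d) + 1 : ℕ) : Cardinal) ≤
      Algebra.trdeg ℚ ↥(adjoin ℚ (Set.range z ∪ Set.range (cexp ∘ z))) := by
  have ht := sub_two_le_trdeg_of_subMinimal z hz hsub
  refine le_trans ?_ ht
  rcases Nat.eq_zero_or_pos l with hl0 | hl0
  · subst hl0
    have : (n - 2 : ℕ) ≥ 1 := by omega
    exact_mod_cast (by simpa using this)
  rcases Nat.eq_zero_or_pos d with hd0 | hd0
  · subst hd0
    have : (n - 2 : ℕ) ≥ 1 := by omega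
    exact_mod_cast (by simpa using this)
  have hd : d ≤ n := grid_side_le_length hz hx (hy.ne_zero ⟨0, hl0⟩) (fun i => hxy i ⟨0, hl0⟩)
  have hl : l ≤ n := grid_side_le_length hz hy (hx.ne_zero ⟨0, hd0⟩)
    (fun j => by rw [mul_comm]; exact hxy ⟨0, hd0⟩ j)
  exact_mod_cast conj23_value_le_sub_two hn hd hl

/-- The same with a uniform «+1» on the Conjecture-2.3 value, from length 7 on. -/
theorem conj23_blind_succ_of_subMinimal {n : ℕ} (hn : 7 ≤ n) (z : Fin n → ℂ) (hz : LinearIndependent ℚ z)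
    (hsub : ∀ (m : ℕ) (w : Fin m → ℂ), m < n → LinearIndependent ℚ w →
      (∀ j, w j ∈ Submodule.span ℚ (Set.range z)) →
      (m : Cardinal) ≤ Algebra.trdeg ℚ ↥(IntermediateField.adjoin ℚ
        (Set.range w ∪ Set.range (Complex.exp ∘ w))) + 1)
    {d l : ℕ} (x : Fin d → ℂ) (y : Fin l → ℂ) (hx : LinearIndependent ℚ x) (hy : LinearIndependent ℚ y)
    (hxy : ∀ i j, x i * y j ∈ Submodule.span ℚ (Set.range z)) :
    ((d * l / (l + d) + 2 : ℕ) : Cardinal) ≤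
      Algebra.trdeg ℚ ↥(adjoin ℚ (Set.range z ∪ Set.range (cexp ∘ z))) := by
  have ht := sub_two_le_trdeg_of_subMinimal z hz hsub
  refine le_trans ?_ ht
  rcases Nat.eq_zero_or_pos l with hl0 | hl0
  · subst hl0
    have : (n - 2 : ℕ) ≥ 2 := by omega
    exact_mod_cast (by simpa using this)
  rcases Nat.eq_zero_or_pos d with hd0 | hd0
  · subst hd0
    have : (n - 2 : ℕ) ≥ 2 := by omega
    exact_mod_cast (by simpa using this)
  have hd : d ≤ n := grid_side_le_length hz hx (hy.ne_zero ⟨0, hl0⟩) (fun i => hxy i ⟨0, hl0⟩)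
  have hl : l ≤ n := grid_side_le_length hz hy (hx.ne_zero ⟨0, hd0⟩)
    (fun j => by rw [mul_comm]; exact hxy ⟨0, hd0⟩ j)
  exact_mod_cast conj23_value_succ_le_sub_two hn hd hl

/-- **GRID BLINDNESS at `n = 4` on the PLAIN sector.**  For a plain span of length 4 at a sub-minimal configuration the only
grid whose Conjecture-2.3 value reaches the threshold `3 = n − 1` would be a `(4,4)` grid — and a `(4,4)` grid inside a
rank-4 span forces the E-STABLE type (`eStable_of_two_dilates`: it is the quartic number-field line of section (b)).
So on `PlainDefectOne`'s length-4 cells the whole numerology is blind as well; on `EStableDefectOne` the `(4,4)` exception is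
real and is exactly the Conjecture-2.3 arrow of section (b). -/
theorem conj23_blind_plain_four (z : Fin 4 → ℂ) (hz : LinearIndependent ℚ z)
    (hP : ∀ β : ℂ, IsAlgebraic ℚ β → (∀ i, β * z i ∈ Submodule.span ℚ (Set.range z)) →
      β ∈ Set.range (algebraMap ℚ ℂ))
    (hsub : ∀ (m : ℕ) (w : Fin m → ℂ), m < 4 → LinearIndependent ℚ w →
      (∀ j, w j ∈ Submodule.span ℚ (Set.range z)) →
      (m : Cardinal) ≤ Algebra.trdeg ℚ ↥(IntermediateField.adjoin ℚ
        (Set.range w ∪ Set.range (Complex.exp ∘ w))) + 1)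
    {d l : ℕ} (x : Fin d → ℂ) (y : Fin l → ℂ) (hx : LinearIndependent ℚ x) (hy : LinearIndependent ℚ y)
    (hxy : ∀ i j, x i * y j ∈ Submodule.span ℚ (Set.range z)) :
    ((d * l / (l + d) + 1 : ℕ) : Cardinal) ≤
      Algebra.trdeg ℚ ↥(adjoin ℚ (Set.range z ∪ Set.range (cexp ∘ z))) := by
  have ht := sub_two_le_trdeg_of_subMinimal z hz hsub
  refine le_trans ?_ ht
  rcases Nat.eq_zero_or_pos l with hl0 | hl0
  · subst hl0
    exact_mod_cast (by simp)
  rcases Nat.eq_zero_or_pos d with hd0 | hd0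
  · subst hd0
    exact_mod_cast (by simp)
  have hd : d ≤ 4 := grid_side_le_length hz hx (hy.ne_zero ⟨0, hl0⟩) (fun i => hxy i ⟨0, hl0⟩)
  have hl : l ≤ 4 := grid_side_le_length hz hy (hx.ne_zero ⟨0, hd0⟩)
    (fun j => by rw [mul_comm]; exact hxy ⟨0, hd0⟩ j)
  by_cases h44 : d = 4 ∧ l = 4
  · exfalso
    obtain ⟨rfl, rfl⟩ := h44
    have hy2 : LinearIndependent ℚ ![y 0, y 1] := by
      have h := hy.comp ![(0 : Fin 4), 1] (by decide)
      have he : y ∘ ![(0 : Fin 4), 1] = ![y 0, y 1] := by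
        ext i; fin_cases i <;> rfl
      rwa [he] at h
    obtain ⟨β, halg, hnq, hst⟩ :=
      eStable_of_two_dilates (by norm_num) z hz x hx hy2 (fun i => hxy i 0) (fun i => hxy i 1)
    exact hnq (hP β halg hst)
  · exact_mod_cast conj23_value_le_two_of_le_four hd hl h44


/-- … and GRID BLINDNESS read on the item: at the first open length `4` of `RootDecomp1E.PlainDefectOne`'s configurations
(plain, sub-minimal) every free grid inside the span has Conjecture-2.3 value `≤ trdeg ℚ(z, e^z)` already. -/
theorem plainDefectOne_four_grid_blind (z : Fin 4 → ℂ) (hz : LinearIndependent ℚ z)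
    (hP : ∀ β : ℂ, IsAlgebraic ℚ β → (∀ i, β * z i ∈ Submodule.span ℚ (Set.range z)) →
      β ∈ Set.range (algebraMap ℚ ℂ))
    (hsub : ∀ (m : ℕ) (w : Fin m → ℂ), m < 4 → LinearIndependent ℚ w →
      (∀ j, w j ∈ Submodule.span ℚ (Set.range z)) →
      (m : Cardinal) ≤ Algebra.trdeg ℚ ↥(IntermediateField.adjoin ℚ
        (Set.range w ∪ Set.range (Complex.exp ∘ w))) + 1)
    {d l : ℕ} (x : Fin d → ℂ) (y : Fin l → ℂ) (hx : LinearIndependent ℚ x) (hy : LinearIndependent ℚ y)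
    (hxy : ∀ i j, x i * y j ∈ Submodule.span ℚ (Set.range z)) :
    ((d * l / (l + d) + 1 : ℕ) : Cardinal) ≤
      Algebra.trdeg ℚ ↥(adjoin ℚ (Set.range z ∪ Set.range (cexp ∘ z))) :=
  conj23_blind_plain_four z hz hP hsub x y hx hy hxy

end Summit.Schanuel.Schanuel.Theorems.RootDecomp1EMultiplicationTypeLeaves

end
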